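import Literature.MathematicalPhysics.QuantumFieldTheory.Balaban1983to89.B5G183RateWTheta

/-!
# Bałaban [CMP 95 (1984)] (1.83)/(1.89) at `U = 1`, order two, weights `W^θ∂ ⊗ W^θ∂`: the FREE-DIAGONAL
piece of the eta-rate has exponent `min(2θ, 1)`

HONEST FRAMING (cell `pub-balaban`, T⁴ programme, estimate NE2 = U1a «η-rate, linear theory»).  Finite
torus, lattice spacing `η = 1/n`, trivial background `U = 1`, one nonzero reduced momentum `p′ = s` at a
time, `ℓ²`-operator norm on the alias classes `× Fin d`.  Nothing here is about infinite volume, `U ≠ 1`,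
a mass gap, or any summit statement.  Bałaban prints NO rate; the currency, King's pairing `ι`/`plant`,
the interpolating weights `W^θ` and every constant are OURS ([folklore]).

WHAT IS PRINTED.  [Balaban1984PropagatorsI] p. 31 (1.83) (free diagonal `δδ/Δ(p′ + l)` of `G(p′)`), p. 32
(1.87) (the `l = l′ = 0` bracket), p. 33: «Proposition 1.1. The operator G is a symmetric operator on
L²(T_η) and ‖GJ‖, ‖∇GJ‖, ‖G∇*J‖, ‖∇G∇*J‖, ‖∇∇GJ‖, ‖G∇*∇*J‖ ≤ γ₀⁻¹‖J‖, (1.89)».  [King1986] p. 672 (4.20)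
`|u(p′+l)| ≤ Π_μ |p′_μ||p′_μ + l_μ|⁻¹`, legends (4.22) «≤ C for α < 1.», (4.23) «≤ CL^{−γk} for α + γ < 1»;
p. 673: «So keeping γ + α < 1, the error produced by the above replacement is bounded by CL^{−γk}.» — King
trades momentum powers `α` against the rate `γ`.  (renders ref1 p015–p017, king p024/p025 read as images
by this lineage.)

WHAT THIS MODULE PROVES (kernel, [folklore]).  With `θ ∈ [0, 1]` King-weight powers on EACH derivative
(`B5G183RateWTheta.wθdSym = (Wc)^θ·∂`) the diagonal piece of the five-piece route obeys
  **`opNorm_dg_piece_Wθ_le`**: `‖diagonal(dg^{(RN)}_{W^θ∂ν, W^θ∂ν′}) − diagonal(extP_R dg^{(N)}_{…})‖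
  ≤ CdgW1(d,a) / N^{min(2θ,1)}`,
entrywise (`dg_entry_diff_le`): on King's `m = 0` classes off the centre the paired rate is
`Cdg2/N^{min(2θ,1)}` (`diag_wθ_rate_le`: the replacement `∂^{(RN)} − ∂^{(N)} = O(‖q̃‖²/N)` costs TWO momentum
powers, `Δ⁻¹` absorbs two, the two weights absorb `W^{2θ}‖q̃‖ ≤ π N^{1−2θ}` resp. `≤ π` — §1), at the centre
`Ccen/N` (`B5G183RateW1Diag.centre_diff_le`; the centre carries no weight), and on the `|m| ≥ 1` classes,
where the planted piece vanishes, `(π²/4)/N^{2θ}` (`diag_wθ_unpaired_le`: `W ≤ 1/N` there).  The real-power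
bookkeeping is §1 (`rpow_weight_mul_le`, `rpow_weight_mul_sq_le`, `rpow_weight_far_le`).  At `θ = 1` this
is `B5G183RateW1Diag.opNorm_dg_piece_W1_le` (rate `1/N`); at `θ = 0` the bound is `O(1)` only, in line with
`B5G183RateObstructionOp`.

NOT CLAIMED: the four finite-rank pieces (they keep the rate `1/N` for every `θ`; separate module), the
assembled `OrderTwoOpRateResidualWθ` bound, sharpness of the exponent, `p′`-derivatives, `∫dp′`, decay,
`U ≠ 1`, constants.
-/

noncomputable section

namespace Literature.MathematicalPhysics.QuantumFieldTheory.Balaban1983to89.B5G183RateWThetaDiag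

open scoped BigOperators ComplexConjugate Matrix.Norms.L2Operator
open Finset Complex
open Literature.MathematicalPhysics.QuantumFieldTheory.Balaban1983to89.B4Strip
open Literature.MathematicalPhysics.QuantumFieldTheory.Balaban1983to89.B5Prop11Fiber
open Literature.MathematicalPhysics.QuantumFieldTheory.Balaban1983to89.B5Prop11Bound
open Literature.MathematicalPhysics.QuantumFieldTheory.Balaban1983to89.B5Hk163Rate
open Literature.MathematicalPhysics.QuantumFieldTheory.Balaban1983to89.B5Hk163RateSum
open Literature.MathematicalPhysics.QuantumFieldTheory.Balaban1983to89.B5G183Rate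
open Literature.MathematicalPhysics.QuantumFieldTheory.Balaban1983to89.B5G183RateSum
open Literature.MathematicalPhysics.QuantumFieldTheory.Balaban1983to89.B5G183RateL2
open Literature.MathematicalPhysics.QuantumFieldTheory.Balaban1983to89.B5G183RateL2Op
open Literature.MathematicalPhysics.QuantumFieldTheory.Balaban1983to89.B5G183RateOp
open Literature.MathematicalPhysics.QuantumFieldTheory.Balaban1983to89.B5G183RateO2Diag
open Literature.MathematicalPhysics.QuantumFieldTheory.Balaban1983to89.B5G183RateO2Op
open Literature.MathematicalPhysics.QuantumFieldTheory.Balaban1983to89.B5G183RatePieces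
open Literature.MathematicalPhysics.QuantumFieldTheory.Balaban1983to89.B5G183RateW1Diag
open Literature.MathematicalPhysics.QuantumFieldTheory.Balaban1983to89.B5G183RateWTheta
open Literature.MathematicalPhysics.QuantumFieldTheory.King1986

variable {d : ℕ}

/-! ## §1 Real-power bookkeeping: what two weights `W^θ` absorb [folklore] -/

section Rpow

/-- `(W^θ)² = W^{2θ}` (`W ≥ 0`). [folklore] -/
theorem rpow_sq_eq {W θ : ℝ} (hW : 0 ≤ W) : (W ^ θ) ^ 2 = W ^ (2 * θ) := by
  rw [← Real.rpow_two, ← Real.rpow_mul hW, mul_comm]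

/-- **two weights absorb ONE momentum power up to `N^{1−min(2θ,1)}`:** for `0 ≤ W ≤ 1`, `0 ≤ x ≤ πN`,
`W·x ≤ π` (King's (4.20): `W‖q̃‖_∞ ≤ π`), `θ ≥ 0`, `N ≥ 1`: `(W^θ)²·x ≤ π·N^{1 − min(2θ,1)}` — for
`2θ ≥ 1` by `W^{2θ} ≤ W`, for `2θ < 1` by `W^{2θ}x = (Wx)^{2θ}·x^{1−2θ} ≤ π^{2θ}(πN)^{1−2θ}`.
[cite: King1986, (4.20), (4.22)–(4.23) p.672] [folklore] -/
theorem rpow_weight_mul_le {W x θ N : ℝ} (hW0 : 0 ≤ W) (hW1 : W ≤ 1) (hx0 : 0 ≤ x)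
    (hxN : x ≤ Real.pi * N) (hWx : W * x ≤ Real.pi) (hθ : 0 ≤ θ) (hN : 1 ≤ N) :
    (W ^ θ) ^ 2 * x ≤ Real.pi * N ^ (1 - min (2 * θ) 1) := by
  have hπ := Real.pi_pos
  have hN0 : 0 ≤ N := by linarith
  rw [rpow_sq_eq hW0]
  rcases le_or_gt 1 (2 * θ) with h1 | h1
  · rw [min_eq_right h1, sub_self, Real.rpow_zero, mul_one]
    have hW2 : W ^ (2 * θ) ≤ W := by
      rcases hW0.eq_or_lt with h0 | h0
      · rw [← h0, Real.zero_rpow (by linarith)]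
      · calc W ^ (2 * θ) ≤ W ^ (1 : ℝ) := Real.rpow_le_rpow_of_exponent_ge h0 hW1 h1
          _ = W := Real.rpow_one W
    calc W ^ (2 * θ) * x ≤ W * x := mul_le_mul_of_nonneg_right hW2 hx0
      _ ≤ Real.pi := hWx
      _ = Real.pi * N ^ (1 - 1 : ℝ) := by rw [sub_self, Real.rpow_zero, mul_one]
      _ = _ := by norm_num
  · rw [min_eq_left h1.le]
    have e : x ^ (2 * θ) * x ^ (1 - 2 * θ) = x := by
      rw [← Real.rpow_add' hx0 (by rw [show 2 * θ + (1 - 2 * θ) = (1 : ℝ) by ring]; exact one_ne_zero),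
        show 2 * θ + (1 - 2 * θ) = (1 : ℝ) by ring, Real.rpow_one]
    calc W ^ (2 * θ) * x = (W * x) ^ (2 * θ) * x ^ (1 - 2 * θ) := by
          rw [Real.mul_rpow hW0 hx0, mul_assoc, e]
      _ ≤ Real.pi ^ (2 * θ) * (Real.pi * N) ^ (1 - 2 * θ) :=
          mul_le_mul (Real.rpow_le_rpow (mul_nonneg hW0 hx0) hWx (by linarith))
            (Real.rpow_le_rpow hx0 hxN (by linarith)) (Real.rpow_nonneg hx0 _)
            (Real.rpow_nonneg hπ.le _)
      _ = Real.pi * N ^ (1 - 2 * θ) := by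
          rw [Real.mul_rpow hπ.le hN0, ← mul_assoc, ← Real.rpow_add hπ,
            show 2 * θ + (1 - 2 * θ) = (1 : ℝ) by ring, Real.rpow_one]

/-- **two weights absorb what they can of TWO momentum powers:** `(W^θ)²·x² ≤ π²·N^{2−2θ}` for
`0 ≤ W`, `0 ≤ x ≤ πN`, `W·x ≤ π`, `0 ≤ θ ≤ 1`, `N ≥ 0`. [cite: King1986, (4.20) p.672] [folklore] -/
theorem rpow_weight_mul_sq_le {W x θ N : ℝ} (hW0 : 0 ≤ W) (hx0 : 0 ≤ x) (hxN : x ≤ Real.pi * N)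
    (hWx : W * x ≤ Real.pi) (hθ0 : 0 ≤ θ) (hθ1 : θ ≤ 1) (hN : 0 ≤ N) :
    (W ^ θ) ^ 2 * x ^ 2 ≤ Real.pi ^ 2 * N ^ (2 - 2 * θ) := by
  have hπ := Real.pi_pos
  rw [rpow_sq_eq hW0]
  have e : x ^ (2 * θ) * x ^ (2 - 2 * θ) = x ^ 2 := by
    rw [← Real.rpow_add' hx0 (by rw [show 2 * θ + (2 - 2 * θ) = (2 : ℝ) by ring]; exact two_ne_zero),
      show 2 * θ + (2 - 2 * θ) = (2 : ℝ) by ring, Real.rpow_two]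
  calc W ^ (2 * θ) * x ^ 2 = (W * x) ^ (2 * θ) * x ^ (2 - 2 * θ) := by
        rw [Real.mul_rpow hW0 hx0, mul_assoc, e]
    _ ≤ Real.pi ^ (2 * θ) * (Real.pi * N) ^ (2 - 2 * θ) :=
        mul_le_mul (Real.rpow_le_rpow (mul_nonneg hW0 hx0) hWx (by linarith))
          (Real.rpow_le_rpow hx0 hxN (by linarith)) (Real.rpow_nonneg hx0 _)
          (Real.rpow_nonneg hπ.le _)
    _ = Real.pi ^ 2 * N ^ (2 - 2 * θ) := by
        rw [Real.mul_rpow hπ.le hN, ← mul_assoc, ← Real.rpow_add hπ,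
          show 2 * θ + (2 - 2 * θ) = (2 : ℝ) by ring, Real.rpow_two]

/-- **far from the origin the weight alone is small:** `W·x ≤ π`, `πN ≤ x`, `N > 0`, `θ ≥ 0` give
`(W^θ)² ≤ N^{−2θ}` (King's `|m| ≥ 1` classes: `‖q̃″‖_∞ ≥ πN`). [cite: King1986, (4.19)–(4.20) p.672]
[folklore] -/
theorem rpow_weight_far_le {W x θ N : ℝ} (hW0 : 0 ≤ W) (hWx : W * x ≤ Real.pi)
    (hfar : Real.pi * N ≤ x) (hN : 0 < N) (hθ : 0 ≤ θ) :
    (W ^ θ) ^ 2 ≤ N ^ (-(2 * θ)) := by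
  have hπ := Real.pi_pos
  rw [rpow_sq_eq hW0]
  have hx : 0 < x := lt_of_lt_of_le (by positivity) hfar
  have hW : W ≤ N⁻¹ :=
    calc W ≤ Real.pi / x := (le_div_iff₀ hx).mpr hWx
      _ ≤ Real.pi / (Real.pi * N) := div_le_div_of_nonneg_left hπ.le (by positivity) hfar
      _ = N⁻¹ := by field_simp
  calc W ^ (2 * θ) ≤ N⁻¹ ^ (2 * θ) := Real.rpow_le_rpow hW0 hW (by linarith)
    _ = N ^ (-(2 * θ)) := by rw [Real.inv_rpow hN.le, Real.rpow_neg hN.le]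

end Rpow

/-! ## §2 The diagonal entries of the `W^θ∂ ⊗ W^θ∂` sandwich [folklore] -/

section Entries

variable {n : ℕ} [NeZero n]

/-- **off the centre** the `W^θ∂_ν ⊗ W^θ∂_{ν′}` diagonal entry of (1.83) is `(Wc^θ)²·w2`
(`B5G183RateO2Diag.w2 = ∂_ν conj ∂_{ν′} Δ⁻¹` at the symmetric representative). [cite:
Balaban1984PropagatorsI, (1.83) p.31] [folklore] -/
theorem dg_wθ_offcentre (hn : 1 ≤ n) (a : ℝ) (ha : 0 < a) {s : Fin d → ℝ}
    (hs : ∀ ν, |s ν| ≤ Real.pi) (hs0 : s ≠ 0) (θ : ℝ) {K : Fin d → Fin n} (hK : K ≠ 0)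
    (ν ν' μ : Fin d) :
    (balabanFiber n hn a ha s hs hs0).dg (fun K => wθdSym n θ K s ν) (fun K => wθdSym n θ K s ν') (K, μ)
      = ((((Wc n K s ^ θ) ^ 2 : ℝ)) : ℂ) * w2 n K s ν ν' := by
  have hΔ : (balabanFiber n hn a ha s hs hs0).Δ K = DeltaXir n 0 (symmAlias n K s) := by
    show DeltaXir n 0 (shiftr n K s) = _
    exact (isRep_symmAlias hn K hs).DeltaXir_eq hn
  have hK' : K ≠ (balabanFiber n hn a ha s hs hs0).o := hK
  unfold Fiber.dg
  dsimp only
  rw [if_neg hK', hΔ]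
  unfold wθdSym w2
  rw [map_mul, Complex.conj_ofReal]
  push_cast
  ring

/-- **at the centre** the `W^θ∂_ν ⊗ W^θ∂_{ν′}` diagonal entry is `W^θ∂_ν(p′)·conj W^θ∂_{ν′}(p′)·dZ_μ(p′)`
(`dZ = (1 + aS₁(μ))/(φ_μ Δ(p′))`, the (1.87) bracket). [cite: Balaban1984PropagatorsI, (1.87) p.32]
[folklore] -/
theorem dg_wθ_centre (hn : 1 ≤ n) (a : ℝ) (ha : 0 < a) {s : Fin d → ℝ}
    (hs : ∀ ν, |s ν| ≤ Real.pi) (hs0 : s ≠ 0) (θ : ℝ) (ν ν' μ : Fin d) :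
    (balabanFiber n hn a ha s hs hs0).dg (fun K => wθdSym n θ K s ν) (fun K => wθdSym n θ K s ν') (0, μ)
      = wθdSym n θ 0 s ν * conj (wθdSym n θ 0 s ν') * ((dZ n a μ s : ℝ) : ℂ) := by
  have ho : (balabanFiber n hn a ha s hs hs0).o = 0 := rfl
  have hS := fiber_S₁_eq hn a ha s hs hs0 μ
  have hφ := fiber_φ_eq hn a ha s hs hs0 μ
  have hΔ := fiber_Δo_eq hn a ha s hs hs0
  rw [ho] at hΔ
  have ha' : (balabanFiber n hn a ha s hs hs0).a = a := rfl
  unfold Fiber.dg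
  dsimp only
  rw [if_pos ho.symm, ho, hS, hφ, hΔ, ha']
  unfold dZ
  push_cast
  ring

/-- the centre class carries no King weight: `W^θ∂_ν(p′) = W∂_ν(p′)` (both `= ∂_ν(p′)`, `Wc n 0 p′ = 1`).
[cite: King1986, (4.20) p.672] [folklore] -/
theorem wθdSym_zero_eq_w1dSym (hn : 1 ≤ n) (θ : ℝ) {s : Fin d → ℝ} (hs : ∀ ν, |s ν| ≤ Real.pi)
    (ν : Fin d) : wθdSym n θ (0 : Fin d → Fin n) s ν = w1dSym n 0 s ν := by
  have h1 : Wc n (0 : Fin d → Fin n) s = 1 := by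
    unfold Wc; rw [jOf_zero hn hs]; simp [aliasWeight]
  unfold wθdSym w1dSym
  rw [h1, Real.one_rpow]

end Entries

/-! ## §3 Paired classes off the centre: the `W^θ ⊗ W^θ` diagonal rate is `Cdg2/N^{min(2θ,1)}` [folklore] -/

section Paired

variable {N R : ℕ} [NeZero N] [NeZero R]

omit [NeZero N] in
/-- **PAIRED diagonal, ORDER-TWO weights with `W^θ` on both sides, eta-rate (every class `k`):**
`(Wc^θ)²·‖w2 (RN) (ιk) − w2 N k‖ ≤ Cdg2/N^{min(2θ,1)}`.  Three-term split as in
`B5G183RateO2Diag.diag_weight2_rate_le` (`θ = 1`): the replacement terms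
`‖∂^{(RN)} − ∂^{(N)}‖·‖∂‖·Δ⁻¹ ≤ (6‖q̃‖²/N)·‖q̃‖·Δ⁻¹` carry `(W^θ)²‖q̃‖ ≤ πN^{1−min(2θ,1)}`
(`rpow_weight_mul_le`), the `Δ⁻¹`-difference term `‖q̃‖²(π²/24)/N²` carries `(W^θ)²‖q̃‖² ≤ π²N^{2−2θ}`
(`rpow_weight_mul_sq_le`). [cite: Balaban1984PropagatorsI, Prop. 1.1 (1.89) p.33; King1986, (4.20),
(4.23) p.672, (4.24), (4.29)–(4.31) p.673] [folklore] -/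
theorem diag_wθ_rate_le (hN : 1 ≤ N) (hR : 1 ≤ R) {s : Fin d → ℝ} (hs : ∀ ν, |s ν| ≤ Real.pi)
    (ν₀ : Fin d) (hν₀ : s ν₀ ≠ 0) (k : Fin d → Fin N) (ν ν' : Fin d) {θ : ℝ} (hθ0 : 0 ≤ θ)
    (hθ1 : θ ≤ 1) :
    (Wc N k s ^ θ) ^ 2 * ‖w2 (R * N) (iota R k s) s ν ν' - w2 N k s ν ν'‖
      ≤ Cdg2 / (N : ℝ) ^ min (2 * θ) 1 := by
  have hπ := Real.pi_pos
  have hN0 : (0 : ℝ) < N := by exact_mod_cast hN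
  have hN1 : (1 : ℝ) ≤ N := by exact_mod_cast hN
  have hRN : 1 ≤ R * N := one_le_RN hN hR
  set m : ℝ := min (2 * θ) 1 with hm
  have hm2 : m ≤ 2 * θ := min_le_left _ _
  have hNm : 0 < (N : ℝ) ^ m := Real.rpow_pos_of_pos hN0 _
  have hNm' : (N : ℝ) ^ m ≠ 0 := hNm.ne'
  have hN2θ : 0 < (N : ℝ) ^ (2 * θ) := Real.rpow_pos_of_pos hN0 _
  have hNm2 : (N : ℝ) ^ m ≤ (N : ℝ) ^ (2 * θ) := Real.rpow_le_rpow_of_exponent_le hN1 hm2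
  unfold w2
  rw [symmAlias_iota hN k hs]
  set q := symmAlias N k s with hqdef
  have hr := isRep_symmAlias hN k hs
  have hpos : 0 < momSq q := momSq_pos_of_rep hs ν₀ hν₀ hr.exists_int
  have hzR : ∀ μ, |q μ| ≤ Real.pi * ((R * N : ℕ) : ℝ) := by
    intro μ
    have h := (isRep_symmAlias hRN (iota R k s) hs).zone μ
    rwa [symmAlias_iota hN k hs] at h
  have hqN : ‖q‖ ≤ Real.pi * N :=
    (pi_norm_le_iff_of_nonneg (by positivity)).mpr fun μ => by
      rw [Real.norm_eq_abs]; exact hr.zone μ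
  -- the four inputs
  have hA : ‖dSym (R * N) (iota R k s) s ν - dSym N k s ν‖ ≤ 6 * ‖q‖ ^ 2 / N :=
    dSym_rate_le hN hR k hs ν
  have hB : ‖conj (dSym (R * N) (iota R k s) s ν') - conj (dSym N k s ν')‖ ≤ 6 * ‖q‖ ^ 2 / N := by
    rw [← map_sub, Complex.norm_conj]; exact dSym_rate_le hN hR k hs ν'
  have hA0 : ‖dSym N k s ν‖ ≤ ‖q‖ := B5G183RateL2.norm_dSym_le hN k s ν
  have hB0 : ‖conj (dSym N k s ν')‖ ≤ ‖q‖ := by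
    rw [Complex.norm_conj]; exact B5G183RateL2.norm_dSym_le hN k s ν'
  have hBR : ‖conj (dSym (R * N) (iota R k s) s ν')‖ ≤ ‖q‖ := by
    rw [Complex.norm_conj]
    have h := B5G183RateL2.norm_dSym_le hRN (iota R k s) s ν'
    rwa [symmAlias_iota hN k hs] at h
  have ha : ‖q‖ ^ 2 * (DeltaXir (R * N) 0 q)⁻¹ ≤ Real.pi ^ 2 / 4 :=
    norm_sq_mul_inv_DeltaXir_le hRN hzR hpos
  have hapos : 0 < (DeltaXir (R * N) 0 q)⁻¹ :=
    inv_pos.mpr (lt_of_lt_of_le (by positivity) (DeltaXir_ge_momSq hRN hzR))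
  have hab : |(DeltaXir (R * N) 0 q)⁻¹ - (DeltaXir N 0 q)⁻¹| ≤ Real.pi ^ 2 / 24 * ((N : ℝ) ^ 2)⁻¹ := by
    rw [abs_sub_comm]; exact diag_paired_rate hN hR hs ν₀ hν₀ k
  -- the weights
  have hW := Wc_nonneg_le_one (n := N) k hs
  have hWx : Wc N k s * ‖q‖ ≤ Real.pi := Wc_mul_norm_le k hs
  have hW0 : 0 ≤ (Wc N k s ^ θ) ^ 2 := sq_nonneg _
  have hq0 : 0 ≤ ‖q‖ := norm_nonneg _
  have hL1 : (Wc N k s ^ θ) ^ 2 * ‖q‖ ≤ Real.pi * (N : ℝ) ^ (1 - m) :=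
    rpow_weight_mul_le hW.1 hW.2 hq0 hqN hWx hθ0 hN1
  have hL2 : (Wc N k s ^ θ) ^ 2 * ‖q‖ ^ 2 ≤ Real.pi ^ 2 * (N : ℝ) ^ (2 - 2 * θ) :=
    rpow_weight_mul_sq_le hW.1 hq0 hqN hWx hθ0 hθ1 hN0.le
  rw [← Complex.ofReal_inv, ← Complex.ofReal_inv]
  refine (mul_le_mul_of_nonneg_left (norm_three_split_le _ _ _ _ _ _) hW0).trans ?_
  rw [abs_of_pos hapos]
  -- term 1
  have t1 : (Wc N k s ^ θ) ^ 2 * (‖dSym (R * N) (iota R k s) s ν - dSym N k s ν‖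
      * ‖conj (dSym (R * N) (iota R k s) s ν')‖ * (DeltaXir (R * N) 0 q)⁻¹)
      ≤ 6 / N * (Real.pi * (N : ℝ) ^ (1 - m)) * (Real.pi ^ 2 / 4) := by
    calc (Wc N k s ^ θ) ^ 2 * (‖dSym (R * N) (iota R k s) s ν - dSym N k s ν‖
          * ‖conj (dSym (R * N) (iota R k s) s ν')‖ * (DeltaXir (R * N) 0 q)⁻¹)
        ≤ (Wc N k s ^ θ) ^ 2 * (6 * ‖q‖ ^ 2 / N * ‖q‖ * (DeltaXir (R * N) 0 q)⁻¹) := by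
          refine mul_le_mul_of_nonneg_left ?_ hW0
          exact mul_le_mul_of_nonneg_right
            (mul_le_mul hA hBR (norm_nonneg _) (by positivity)) hapos.le
      _ = 6 / N * ((Wc N k s ^ θ) ^ 2 * ‖q‖) * (‖q‖ ^ 2 * (DeltaXir (R * N) 0 q)⁻¹) := by ring
      _ ≤ 6 / N * (Real.pi * (N : ℝ) ^ (1 - m)) * (Real.pi ^ 2 / 4) :=
          mul_le_mul (mul_le_mul_of_nonneg_left hL1 (by positivity)) ha (by positivity)
            (by positivity)
  -- term 2
  have t2 : (Wc N k s ^ θ) ^ 2 * (‖dSym N k s ν‖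
      * ‖conj (dSym (R * N) (iota R k s) s ν') - conj (dSym N k s ν')‖ * (DeltaXir (R * N) 0 q)⁻¹)
      ≤ 6 / N * (Real.pi * (N : ℝ) ^ (1 - m)) * (Real.pi ^ 2 / 4) := by
    calc (Wc N k s ^ θ) ^ 2 * (‖dSym N k s ν‖
          * ‖conj (dSym (R * N) (iota R k s) s ν') - conj (dSym N k s ν')‖ * (DeltaXir (R * N) 0 q)⁻¹)
        ≤ (Wc N k s ^ θ) ^ 2 * (‖q‖ * (6 * ‖q‖ ^ 2 / N) * (DeltaXir (R * N) 0 q)⁻¹) := by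
          refine mul_le_mul_of_nonneg_left ?_ hW0
          exact mul_le_mul_of_nonneg_right (mul_le_mul hA0 hB (norm_nonneg _) hq0) hapos.le
      _ = 6 / N * ((Wc N k s ^ θ) ^ 2 * ‖q‖) * (‖q‖ ^ 2 * (DeltaXir (R * N) 0 q)⁻¹) := by ring
      _ ≤ 6 / N * (Real.pi * (N : ℝ) ^ (1 - m)) * (Real.pi ^ 2 / 4) :=
          mul_le_mul (mul_le_mul_of_nonneg_left hL1 (by positivity)) ha (by positivity)
            (by positivity)
  -- term 3
  have t3 : (Wc N k s ^ θ) ^ 2 * (‖dSym N k s ν‖ * ‖conj (dSym N k s ν')‖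
      * |(DeltaXir (R * N) 0 q)⁻¹ - (DeltaXir N 0 q)⁻¹|)
      ≤ Real.pi ^ 2 * (N : ℝ) ^ (2 - 2 * θ) * (Real.pi ^ 2 / 24 * ((N : ℝ) ^ 2)⁻¹) := by
    calc (Wc N k s ^ θ) ^ 2 * (‖dSym N k s ν‖ * ‖conj (dSym N k s ν')‖
          * |(DeltaXir (R * N) 0 q)⁻¹ - (DeltaXir N 0 q)⁻¹|)
        ≤ (Wc N k s ^ θ) ^ 2 * (‖q‖ * ‖q‖ * (Real.pi ^ 2 / 24 * ((N : ℝ) ^ 2)⁻¹)) := by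
          refine mul_le_mul_of_nonneg_left ?_ hW0
          exact mul_le_mul (mul_le_mul hA0 hB0 (norm_nonneg _) hq0) hab (abs_nonneg _)
            (by positivity)
      _ = (Wc N k s ^ θ) ^ 2 * ‖q‖ ^ 2 * (Real.pi ^ 2 / 24 * ((N : ℝ) ^ 2)⁻¹) := by ring
      _ ≤ Real.pi ^ 2 * (N : ℝ) ^ (2 - 2 * θ) * (Real.pi ^ 2 / 24 * ((N : ℝ) ^ 2)⁻¹) :=
          mul_le_mul_of_nonneg_right hL2 (by positivity)
  have hsum := add_le_add (add_le_add t1 t2) t3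
  rw [mul_add, mul_add]
  refine hsum.trans ?_
  -- `N^{1−m}/N = 1/N^m`, `N^{2−2θ}/N² = 1/N^{2θ} ≤ 1/N^m`
  have e1 : 6 / (N : ℝ) * (Real.pi * (N : ℝ) ^ (1 - m)) * (Real.pi ^ 2 / 4)
      = 6 * Real.pi * (Real.pi ^ 2 / 4) / (N : ℝ) ^ m := by
    rw [Real.rpow_sub hN0, Real.rpow_one]
    field_simp
  have e3 : Real.pi ^ 2 * (N : ℝ) ^ (2 - 2 * θ) * (Real.pi ^ 2 / 24 * ((N : ℝ) ^ 2)⁻¹)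
      = Real.pi ^ 2 * (Real.pi ^ 2 / 24) / (N : ℝ) ^ (2 * θ) := by
    rw [Real.rpow_sub hN0, Real.rpow_two]
    field_simp
  have h3 : Real.pi ^ 2 * (Real.pi ^ 2 / 24) / (N : ℝ) ^ (2 * θ)
      ≤ Real.pi ^ 2 * (Real.pi ^ 2 / 24) / (N : ℝ) ^ m :=
    div_le_div_of_nonneg_left (by positivity) hNm hNm2
  rw [e1, e3]
  calc 6 * Real.pi * (Real.pi ^ 2 / 4) / (N : ℝ) ^ m + 6 * Real.pi * (Real.pi ^ 2 / 4) / (N : ℝ) ^ m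
        + Real.pi ^ 2 * (Real.pi ^ 2 / 24) / (N : ℝ) ^ (2 * θ)
      ≤ 6 * Real.pi * (Real.pi ^ 2 / 4) / (N : ℝ) ^ m + 6 * Real.pi * (Real.pi ^ 2 / 4) / (N : ℝ) ^ m
        + Real.pi ^ 2 * (Real.pi ^ 2 / 24) / (N : ℝ) ^ m := by linarith
    _ = Cdg2 / (N : ℝ) ^ m := by unfold Cdg2; field_simp; ring

end Paired

/-! ## §4 Unpaired classes: the weights alone give `(π²/4)/N^{2θ}` [folklore] -/

section Unpaired

variable {N R : ℕ} [NeZero N] [NeZero R]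

omit [NeZero N] in
/-- **UNPAIRED diagonal, `W^θ` on both sides:** on King's `|m| ≥ 1` classes (`‖q̃″‖_∞ ≥ πN`)
`(Wc^θ)²·‖w2 (RN) k″‖ ≤ (π²/4)/N^{2θ}`: `‖w2‖ ≤ ‖q̃″‖²Δ⁻¹ ≤ π²/4` and `Wc ≤ π/‖q̃″‖ ≤ 1/N`
(`rpow_weight_far_le`).  At `θ = 0` this entry is `O(1)` (it equals `1` when `q̃″ ∥ e_ν`, `ν = ν′`).
[cite: King1986, (4.19)–(4.20) p.672; Balaban1984PropagatorsI, Prop. 1.1 (1.89) p.33] [folklore] -/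
theorem diag_wθ_unpaired_le (hN : 1 ≤ N) (hR : 1 ≤ R) {s : Fin d → ℝ} (hs : ∀ ν, |s ν| ≤ Real.pi)
    {k'' : Fin d → Fin (R * N)} (hu : ∀ k : Fin d → Fin N, iota R k s ≠ k'') (ν ν' : Fin d)
    {θ : ℝ} (hθ0 : 0 ≤ θ) :
    (Wc (R * N) k'' s ^ θ) ^ 2 * ‖w2 (R * N) k'' s ν ν'‖ ≤ Real.pi ^ 2 / 4 / (N : ℝ) ^ (2 * θ) := by
  have hπ := Real.pi_pos
  have hN0 : (0 : ℝ) < N := by exact_mod_cast hN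
  have hRN : 1 ≤ R * N := one_le_RN hN hR
  unfold w2
  set q := symmAlias (R * N) k'' s with hqdef
  have hr := isRep_symmAlias hRN k'' hs
  have hfar : Real.pi * N ≤ ‖q‖ := norm_ge_of_unpaired hN hs hu
  have hqpos : 0 < ‖q‖ := lt_of_lt_of_le (by positivity) hfar
  have hmpos : 0 < momSq q := lt_of_lt_of_le (by positivity) (norm_sq_le_momSq q)
  have ha : ‖q‖ ^ 2 * (DeltaXir (R * N) 0 q)⁻¹ ≤ Real.pi ^ 2 / 4 :=
    norm_sq_mul_inv_DeltaXir_le hRN hr.zone hmpos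
  have hapos : 0 < (DeltaXir (R * N) 0 q)⁻¹ :=
    inv_pos.mpr (lt_of_lt_of_le (by positivity) (DeltaXir_ge_momSq hRN hr.zone))
  have hA : ‖dSym (R * N) k'' s ν‖ ≤ ‖q‖ := B5G183RateL2.norm_dSym_le hRN k'' s ν
  have hB : ‖conj (dSym (R * N) k'' s ν')‖ ≤ ‖q‖ := by
    rw [Complex.norm_conj]; exact B5G183RateL2.norm_dSym_le hRN k'' s ν'
  have hW := Wc_nonneg_le_one (n := R * N) k'' hs
  have hWx : Wc (R * N) k'' s * ‖q‖ ≤ Real.pi := Wc_mul_norm_le k'' hs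
  -- ‖w2‖ ≤ ‖q‖²·Δ⁻¹ ≤ π²/4
  have hw : ‖dSym (R * N) k'' s ν * conj (dSym (R * N) k'' s ν')
      * ((DeltaXir (R * N) 0 q : ℝ) : ℂ)⁻¹‖ ≤ ‖q‖ ^ 2 * (DeltaXir (R * N) 0 q)⁻¹ := by
    rw [← Complex.ofReal_inv, norm_mul, norm_mul, Complex.norm_real, Real.norm_eq_abs,
      abs_of_pos hapos, sq]
    exact mul_le_mul_of_nonneg_right (mul_le_mul hA hB (norm_nonneg _) (norm_nonneg _)) hapos.le
  -- (Wc^θ)² ≤ N^{−2θ}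
  have hWq : (Wc (R * N) k'' s ^ θ) ^ 2 ≤ (N : ℝ) ^ (-(2 * θ)) :=
    rpow_weight_far_le hW.1 hWx hfar hN0 hθ0
  calc (Wc (R * N) k'' s ^ θ) ^ 2 * ‖dSym (R * N) k'' s ν * conj (dSym (R * N) k'' s ν')
        * ((DeltaXir (R * N) 0 q : ℝ) : ℂ)⁻¹‖
      ≤ (N : ℝ) ^ (-(2 * θ)) * (Real.pi ^ 2 / 4) :=
        mul_le_mul hWq (hw.trans ha) (norm_nonneg _) (Real.rpow_nonneg hN0.le _)
    _ = Real.pi ^ 2 / 4 / (N : ℝ) ^ (2 * θ) := by rw [Real.rpow_neg hN0.le]; ring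

end Unpaired

/-! ## §5 The diagonal piece of the `W^θ∂ ⊗ W^θ∂` residual is `O(N^{−min(2θ,1)})` [folklore] -/

section Main

variable {N R : ℕ} [NeZero N] [NeZero R]

/-- **entrywise bound of the diagonal piece difference, weights `W^θ`:** for every class `K` of level
`RN` and every component `μ`, `‖dg^{(RN)}(K, μ) − (extP dg^{(N)})(K, μ)‖ ≤ CdgW1/N^{min(2θ,1)}` —
King's `m = 0` classes `K = ιk` off the centre (`diag_wθ_rate_le`), the centre `ι0 = 0`
(`B5G183RateW1Diag.centre_diff_le`, no weight there), and the `|m| ≥ 1` classes where the planted piece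
vanishes (`diag_wθ_unpaired_le`, `N^{−2θ} ≤ N^{−min(2θ,1)}`). [cite: King1986, (4.19)–(4.20), (4.23)
p.672; Balaban1984PropagatorsI, (1.87) p.32, Prop. 1.1 (1.89) p.33] [folklore] -/
theorem dg_entry_diff_le (hN : 1 ≤ N) (hR : 1 ≤ R) (hRN : 1 ≤ R * N) (a : ℝ) (ha : 0 < a)
    {s : Fin d → ℝ} (hs : ∀ ν, |s ν| ≤ Real.pi) (hs0 : s ≠ 0) {θ : ℝ} (hθ0 : 0 ≤ θ) (hθ1 : θ ≤ 1)
    (ν ν' : Fin d) (I : (Fin d → Fin (R * N)) × Fin d) :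
    ‖(balabanFiber (R * N) hRN a ha s hs hs0).dg (fun K => wθdSym (R * N) θ K s ν)
          (fun K => wθdSym (R * N) θ K s ν') I
        - extP R s ((balabanFiber N hN a ha s hs hs0).dg (fun k => wθdSym N θ k s ν)
          (fun k => wθdSym N θ k s ν')) I‖
      ≤ CdgW1 d a / (N : ℝ) ^ min (2 * θ) 1 := by
  obtain ⟨ν₀, hν₀⟩ : ∃ ν, s ν ≠ 0 := Function.ne_iff.mp hs0
  obtain ⟨K, μ⟩ := I
  have hπ := Real.pi_pos
  have hN0 : (0 : ℝ) < N := by exact_mod_cast hN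
  have hN1 : (1 : ℝ) ≤ N := by exact_mod_cast hN
  have hC2 := Cdg2_nonneg
  have hCc := (Ccen_nonneg d ha).2
  set m : ℝ := min (2 * θ) 1 with hm
  have hm1 : m ≤ 1 := min_le_right _ _
  have hm2 : m ≤ 2 * θ := min_le_left _ _
  have hNm : 0 < (N : ℝ) ^ m := Real.rpow_pos_of_pos hN0 _
  have hNm1 : (N : ℝ) ^ m ≤ N := by
    calc (N : ℝ) ^ m ≤ (N : ℝ) ^ (1 : ℝ) := Real.rpow_le_rpow_of_exponent_le hN1 hm1
      _ = N := Real.rpow_one _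
  have hNm2 : (N : ℝ) ^ m ≤ (N : ℝ) ^ (2 * θ) := Real.rpow_le_rpow_of_exponent_le hN1 hm2
  have hCW : Cdg2 ≤ CdgW1 d a ∧ Ccen d a ≤ CdgW1 d a ∧ Real.pi ^ 2 / 4 ≤ CdgW1 d a := by
    unfold CdgW1; refine ⟨?_, ?_, ?_⟩ <;> nlinarith [sq_nonneg Real.pi]
  by_cases hp : ∃ k : Fin d → Fin N, iota R k s = K
  · obtain ⟨k, rfl⟩ := hp
    rw [extP_iota hN hs]
    by_cases hk : k = 0
    · -- the centre: no weight
      subst hk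
      rw [iota_zero hN hs, dg_wθ_centre hRN a ha hs hs0 θ ν ν' μ, dg_wθ_centre hN a ha hs hs0 θ ν ν' μ,
        wθdSym_zero_eq_w1dSym hRN θ hs ν, wθdSym_zero_eq_w1dSym hRN θ hs ν',
        wθdSym_zero_eq_w1dSym hN θ hs ν, wθdSym_zero_eq_w1dSym hN θ hs ν']
      calc _ ≤ Ccen d a / N := centre_diff_le hN hR a ha hs hs0 ν ν' μ
        _ ≤ Ccen d a / (N : ℝ) ^ m := div_le_div_of_nonneg_left hCc hNm hNm1
        _ ≤ CdgW1 d a / (N : ℝ) ^ m := div_le_div_of_nonneg_right hCW.2.1 hNm.le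
    · -- paired, off the centre
      have hK : iota R k s ≠ 0 := fun h =>
        hk (iota_injective hN hs (h.trans (iota_zero hN hs).symm))
      rw [dg_wθ_offcentre hRN a ha hs hs0 θ hK ν ν' μ, dg_wθ_offcentre hN a ha hs hs0 θ hk ν ν' μ,
        Wc_iota hN k hs, ← mul_sub, norm_mul, Complex.norm_real, Real.norm_eq_abs,
        abs_of_nonneg (sq_nonneg _)]
      calc _ ≤ Cdg2 / (N : ℝ) ^ m := diag_wθ_rate_le hN hR hs ν₀ hν₀ k ν ν' hθ0 hθ1
        _ ≤ CdgW1 d a / (N : ℝ) ^ m := div_le_div_of_nonneg_right hCW.1 hNm.le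
  · -- unpaired: the planted piece vanishes
    push Not at hp
    have hK : K ≠ 0 := fun h => hp 0 ((iota_zero hN hs).trans h.symm)
    rw [extP_unpaired _ hp, sub_zero, dg_wθ_offcentre hRN a ha hs hs0 θ hK ν ν' μ, norm_mul,
      Complex.norm_real, Real.norm_eq_abs, abs_of_nonneg (sq_nonneg _)]
    calc _ ≤ Real.pi ^ 2 / 4 / (N : ℝ) ^ (2 * θ) := diag_wθ_unpaired_le hN hR hs hp ν ν' hθ0
      _ ≤ Real.pi ^ 2 / 4 / (N : ℝ) ^ m := div_le_div_of_nonneg_left (by positivity) hNm hNm2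
      _ ≤ CdgW1 d a / (N : ℝ) ^ m := div_le_div_of_nonneg_right hCW.2.2 hNm.le

/-- **THE DIAGONAL PIECE OF THE `W^θ∂_ν ⊗ W^θ∂_{ν′}` ORDER-TWO eta-RATE IS `O(N^{−min(2θ,1)})`:** for
`N, R ≥ 1`, `a > 0`, `θ ∈ [0, 1]`, a nonzero reduced momentum `p′ = s` of the zone and directions `ν, ν′`,
`‖diagonal(dg^{(RN)}) − diagonal(extP_R dg^{(N)})‖_(ℓ²→ℓ²) ≤ CdgW1(d,a)/N^{min(2θ,1)}` — the first of the
five piece differences of `B5G183RatePieces.residual_eq_pieces` for the weights of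
`B5G183RateWTheta`; `θ = 1` is `B5G183RateW1Diag.opNorm_dg_piece_W1_le`. [cite: Balaban1984PropagatorsI,
(1.83) p.31, (1.87) p.32, Prop. 1.1 (1.89) p.33; King1986, (4.19)–(4.20), (4.23) p.672, (4.24) p.673]
[folklore] -/
theorem opNorm_dg_piece_Wθ_le (hN : 1 ≤ N) (hR : 1 ≤ R) (hRN : 1 ≤ R * N) (a : ℝ) (ha : 0 < a)
    {s : Fin d → ℝ} (hs : ∀ ν, |s ν| ≤ Real.pi) (hs0 : s ≠ 0) {θ : ℝ} (hθ0 : 0 ≤ θ) (hθ1 : θ ≤ 1)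
    (ν ν' : Fin d) :
    ‖Matrix.diagonal ((balabanFiber (R * N) hRN a ha s hs hs0).dg (fun K => wθdSym (R * N) θ K s ν)
          (fun K => wθdSym (R * N) θ K s ν'))
        - Matrix.diagonal (extP R s ((balabanFiber N hN a ha s hs hs0).dg
          (fun k => wθdSym N θ k s ν) (fun k => wθdSym N θ k s ν')))‖
      ≤ CdgW1 d a / (N : ℝ) ^ min (2 * θ) 1 := by
  have hN0 : (0 : ℝ) < N := by exact_mod_cast hN
  exact opNorm_diagonal_sub_le _ _ (div_nonneg (CdgW1_nonneg d ha) (Real.rpow_nonneg hN0.le _))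
    fun I => dg_entry_diff_le hN hR hRN a ha hs hs0 hθ0 hθ1 ν ν' I

end Main

end Literature.MathematicalPhysics.QuantumFieldTheory.Balaban1983to89.B5G183RateWThetaDiag
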